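import Mathlib
import Summits.Ventures.PercRepro2.A3PendantFreeMarks
import Summits.Ventures.PercRepro2.A3PendantFreeRow
import Summits.Ventures.PercRepro2.A3PendantO
import Summits.Ventures.PercRepro2.CrossWeightedBHK

/-!
# (MEANS-a₃) when the explored vertex IS a mark
(blind cell PercRepro2, night-1 g32; proofs/NIGHT1-G32.md §6)

On the fibres of a mark `x` its own masses are `Ssig_x = s3 · m_W`, `Su_x = (s3)² · m_W` (A3FibreMark,
A3PendantFreeMarks).  Hence:
* **`btw_self_o`**: `btw(o) = 0` identically — the centring `γ` vanishes (`D_o = 0` when `a₃ = o`), so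
  `F = 0` on every fibre and the `PD`-part has `U_o = 0`;
* **`btw_self_b_mul`**: `btw(b) · D · P(Q) = TM`, the cleared two-means form of g29's
  `CrossWeighted.twoMeans_nonneg` — the `q = 1` endpoint of g30's `btw_pendant_b`, computed directly;
  hence **`A3Between_self_b`**;
* at a root, `PD = ∅` (`PDEvent_self_left`, `PDEvent_self_right`) and p5's `A3Between_of_PD_null` applies;
* **`A3Between_self_mark`**: (MEANS-a₃) holds whenever `a₃ ∈ {o, b, a₁, a₂}`.
Exact census before the proof: mining/night-1/g32/check_mark_self2.py (100 instances: `btw(o) = 0` on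
all, `btw(b) ≥ 0` on all, `> 0` on 17) and check_self_b.py (`btw(b) D P(Q) = TM` on 60/60).
Standard axioms.
-/

namespace Summit.Ventures.PercRepro2

open UnionCluster CovForm

namespace CovForm

namespace A3Fibre

section Self

variable {V : Type*} {E : Type*} [Fintype V] [DecidableEq V] [Fintype E] [DecidableEq E]
  {R : Type*} [Field R] [LinearOrder R] [IsStrictOrderedRing R]

omit [LinearOrder R] [IsStrictOrderedRing R] in
/-- **`btw` vanishes at `o`**: the centring is `0` and `U_o = 0` on the `PD`-fibres. -/
theorem btw_self_o (p : E → R) (ends : E → Sym2 V) (o a₁ a₂ b : V) :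
    btw p ends o a₁ a₂ o b = 0 := by
  have hγ : gamma p ends o a₁ a₂ o = 0 := by
    unfold gamma
    rw [Do_eq_fibresA, sum_SuA_self, zero_div]
  have hSF : ∀ W : Finset V, SF p ends o a₁ a₂ o W = 0 := by
    intro W
    unfold SF
    rw [hγ, Ssig_self, Su_self]
    unfold s3
    split_ifs <;> ring
  unfold btw
  simp only [hSF, mul_zero, zero_div, Finset.sum_const_zero, sub_zero]
  rw [sum_termA_self, sum_SuA_self]
  ring

omit [Fintype V] [DecidableEq V] [Fintype E] [DecidableEq E] [Field R] [LinearOrder R]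
  [IsStrictOrderedRing R] in
/-- `PD` is empty when the explored vertex is the first root. -/
lemma PDEvent_self_left (ends : E → Sym2 V) (a₁ a₂ : V) : PDEvent ends a₁ a₂ a₁ = ∅ := by
  ext ω
  simp only [PDEvent, Dtilde, UnionCluster.inU, Set.mem_inter_iff, Set.mem_compl_iff, Set.mem_union,
    mem_connEvent, Set.mem_empty_iff_false, iff_false, not_and, not_not]
  intro _
  exact Or.inl (conn_refl ends ω a₁)

omit [Fintype V] [DecidableEq V] [Fintype E] [DecidableEq E] [Field R] [LinearOrder R]
  [IsStrictOrderedRing R] in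
/-- `PD` is empty when the explored vertex is the second root. -/
lemma PDEvent_self_right (ends : E → Sym2 V) (a₁ a₂ : V) : PDEvent ends a₁ a₂ a₂ = ∅ := by
  ext ω
  simp only [PDEvent, Dtilde, UnionCluster.inU, Set.mem_inter_iff, Set.mem_compl_iff, Set.mem_union,
    mem_connEvent, Set.mem_empty_iff_false, iff_false, not_and, not_not]
  intro _
  exact Or.inr (conn_refl ends ω a₂)

/-- **`btw` at `b`, cleared**: `btw(b) · D · P(Q) = TM` with `TM` the two-means form of g29's
`CrossWeighted.twoMeans_nonneg`, written in the `PD_b`-masses `P(Q, b ∉ U, o ∈ C_i)`. -/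
theorem btw_self_b_mul {p : E → R} (hp : IsProbVec p) (ends : E → Sym2 V) (o a₁ a₂ b : V)
    (hQ : prob p (avoidAll ends a₂ {a₁}) ≠ 0) (hD : prob p (PDEvent ends a₁ a₂ b) ≠ 0) :
    btw p ends o a₁ a₂ b b * prob p (PDEvent ends a₁ a₂ b) * prob p (avoidAll ends a₂ {a₁}) =
      2 * (prob p (avoidAll ends a₂ {a₁}) - prob p (avoidAll ends a₂ {a₁} ∩ connEvent ends a₁ b) +
            prob p (avoidAll ends a₂ {a₁} ∩ connEvent ends a₂ b)) *
          (prob p (avoidAll ends a₂ {a₁} ∩ connEvent ends a₁ b) *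
              prob p (PDEvent ends a₁ a₂ b ∩ connEvent ends a₂ o) -
            prob p (PDEvent ends a₁ a₂ b) *
              prob p (avoidAll ends a₂ {a₁} ∩ connEvent ends a₁ b ∩ connEvent ends a₂ o)) +
        2 * (prob p (avoidAll ends a₂ {a₁}) + prob p (avoidAll ends a₂ {a₁} ∩ connEvent ends a₁ b) -
            prob p (avoidAll ends a₂ {a₁} ∩ connEvent ends a₂ b)) *
          (prob p (avoidAll ends a₂ {a₁} ∩ connEvent ends a₂ b) *
              prob p (PDEvent ends a₁ a₂ b ∩ connEvent ends a₁ o) -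
            prob p (PDEvent ends a₁ a₂ b) *
              prob p (avoidAll ends a₂ {a₁} ∩ connEvent ends a₂ b ∩ connEvent ends a₁ o)) := by
  rw [← RootEdge.btwg_gamma p ends o a₁ a₂ b b]
  unfold RootEdge.btwg
  -- the ratio terms collapse: `Ssig_b = s3 · m_W`
  have h1 : ∀ W : Finset V, Ssig p ends a₁ a₂ b b W *
      RootEdge.SFg p ends o a₁ a₂ b (gamma p ends o a₁ a₂ b) W / mW p ends a₁ a₂ b W =
      s3 a₁ a₂ W * Ssig p ends a₁ a₂ b o W +
        gamma p ends o a₁ a₂ b * (s3 a₁ a₂ W ^ 2 * mW p ends a₁ a₂ b W) -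
        s3 a₁ a₂ W ^ 2 * Su p ends a₁ a₂ b o W := by
    intro W
    rw [Ssig_self]
    by_cases hm : mW p ends a₁ a₂ b W = 0
    · rw [hm, Ssig_eq_zero_of_mW_eq_zero hp ends a₁ a₂ b o W hm,
        Su_eq_zero_of_mW_eq_zero hp ends a₁ a₂ b o W hm]
      ring
    · unfold RootEdge.SFg
      field_simp
      ring
  rw [Finset.sum_congr rfl (fun W _ => h1 W), Finset.sum_sub_distrib, Finset.sum_add_distrib,
    ← Finset.mul_sum, ← EQb3_eq, sum_s3_sq_Su hp]
  have h2 : ∑ W : Finset V, (s3 a₁ a₂ W : R) ^ 2 * mW p ends a₁ a₂ b W = LeafStep.mU p ends a₁ a₂ b := by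
    unfold LeafStep.mU
    rw [← sum_Su p ends a₁ a₂ b b]
    exact Finset.sum_congr rfl fun W _ => (Su_self p ends a₁ a₂ b W).symm
  rw [h2, Finset.sum_congr rfl (fun W _ => Ssig_self p ends a₁ a₂ b W), ← EQ3_eq,
    sum_SFg_affine, sum_SFg_zero, ← EQo_eq p ends o a₁ a₂ b, ← EQ3_eq, ← EQ3o_eq, sum_termA_self',
    sum_SuA_self, fibresA, Finset.sum_filter, ← Do_eq, EQb3_self, EQ3_self, EQ3o_self]
  unfold gamma
  rw [Do_self, prob_PD_self, LeafStep.prob_PD_inter_v, LeafStep.prob_PD_inter_v]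
  rw [prob_PD_self] at hD
  unfold LeafStep.mU at hD
  unfold EQbo EQo LeafStep.mU
  simp only [Set.inter_comm, Set.inter_left_comm]
  field_simp
  ring

/-- **(MEANS-a₃) at `b`** (the two-means inequality of g29). -/
theorem A3Between_self_b {p : E → R} (hp : IsProbVec p) (ends : E → Sym2 V) (o a₁ a₂ b : V) :
    A3Between p ends o a₁ a₂ b b := by
  rcases eq_or_ne (prob p (PDEvent ends a₁ a₂ b)) 0 with hD | hD
  · exact RootEdge.A3Between_of_PD_null p hp o b hD
  rcases eq_or_ne (prob p (avoidAll ends a₂ {a₁})) 0 with hQ | hQ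
  · unfold A3Between
    rw [btw_eq_zero_of_prob_Q_eq_zero hp ends o a₁ a₂ b b hQ]
  unfold A3Between
  have hDpos : 0 < prob p (PDEvent ends a₁ a₂ b) := lt_of_le_of_ne (prob_nonneg hp _) (Ne.symm hD)
  have hQpos : 0 < prob p (avoidAll ends a₂ {a₁}) := lt_of_le_of_ne (prob_nonneg hp _) (Ne.symm hQ)
  have hTM := CrossWeighted.twoMeans_nonneg p hp ends o a₁ a₂ b
  have hN : avoidAll ends a₂ {a₁} ∩ ((connEvent ends a₁ b)ᶜ ∩ (connEvent ends a₂ b)ᶜ) =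
      PDEvent ends a₁ a₂ b := by
    ext ω
    simp only [PDEvent, Dtilde, UnionCluster.inU, Set.mem_inter_iff, Set.mem_compl_iff, Set.mem_union,
      mem_connEvent, mem_avoidAll, Finset.mem_singleton, forall_eq, not_or]
    constructor
    · rintro ⟨hQ', h1', h2'⟩
      exact ⟨fun hc => hQ' (conn_symm hc), fun hc => h1' (conn_symm hc), fun hc => h2' (conn_symm hc)⟩
    · rintro ⟨hQ', h1', h2'⟩
      exact ⟨fun hc => hQ' (conn_symm hc), fun hc => h1' (conn_symm hc), fun hc => h2' (conn_symm hc)⟩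
  rw [hN] at hTM
  have key := btw_self_b_mul hp ends o a₁ a₂ b hQ hD
  have hprod : 0 < prob p (PDEvent ends a₁ a₂ b) * prob p (avoidAll ends a₂ {a₁}) :=
    mul_pos hDpos hQpos
  have : 0 ≤ btw p ends o a₁ a₂ b b * (prob p (PDEvent ends a₁ a₂ b) * prob p (avoidAll ends a₂ {a₁})) := by
    rw [← mul_assoc, key]
    exact hTM
  exact nonneg_of_mul_nonneg_left this hprod

/-- **(MEANS-a₃) whenever the explored vertex is a mark.** -/
theorem A3Between_self_mark {p : E → R} (hp : IsProbVec p) (ends : E → Sym2 V) {o a₁ a₂ b x : V}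
    (hx : x = o ∨ x = b ∨ x = a₁ ∨ x = a₂) : A3Between p ends o a₁ a₂ x b := by
  rcases hx with rfl | rfl | rfl | rfl
  · unfold A3Between
    rw [btw_self_o]
  · exact A3Between_self_b hp ends o a₁ a₂ x
  · exact RootEdge.A3Between_of_PD_null p hp o b (by rw [PDEvent_self_left, prob_empty])
  · exact RootEdge.A3Between_of_PD_null p hp o b (by rw [PDEvent_self_right, prob_empty])

end Self

end A3Fibre

end CovForm

end Summit.Ventures.PercRepro2
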